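import Summits.QuantumFields.YangMills.Theorems.WeakCouplingRatesCurrency

/-!
# Weak-coupling RATES below the Clay horizon — part 2/3: the PROVED rung XI-DIV for every compact simple `G` (`d = 4`)

Part 2 of the leaf module of cell `ym-beyond`, seat P3 «lower the summit honestly» (memo of record `run/shared/lean/pub/ym-beyond/ROUTE-P3.md`
v9 §12–§13); part 1 `WeakCouplingRatesCurrency` carries the full module description, honest framing and references.  Contents of
this part (§4 of the source, verbatim):
* §4 PROVED RUNG: XI-DIV for EVERY compact simple `G` in `d = 4` (`massGapVanishesOf_allSimpleG`), from the tree's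
  `EquipartitionPinsProbe_proof ∘ freeEnergyLogCoefficient_proof` (route `EquipartitionCriticality`, items 8759/8760) by translation
  invariance of torus-limit states (`integral_comp_configShift_of_mem_limitPoints`) and the two-time form of the spectral bound.
WHAT THIS IS NOT: not the Clay mass gap (`m > 0`), not confinement, not a continuum limit; XI-DIV bounds RP-spectral gaps from ABOVE.

FILING NOTE (courier). Filed for the cell by its courier seat (ym-beyond-courier g2) VERBATIM from `run/shared/lean/pub/ym-
beyond/LIFT-P3-WeakCouplingRates.lean` (sha16 d721fbe54c9c8af9, author P3 g9), re-partitioned into THREE tree modules because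
Theorems files are capped at 400 lines (gate `lint.size`): `WeakCouplingRatesCurrency` = §1–§3, `WeakCouplingRatesRung` = §4,
`WeakCouplingRates` = §5–§6, import chain 1 → 2 → 3, ONE namespace `Summit.QuantumFields.YangMills.Theorems.WeakCouplingRates`,
every declaration byte-identical and in source order.  Courier deltas, exhaustively: this note; the short module docstrings of parts
2–3; the re-opened `section` / `variable` preambles of parts 2–3 (copies of the source lines 65–80 and 180); three one-line
docstrings demanded by `lint.docstring` (on `timeShiftLG_zero`, `continuous_bounded_plaqCost0`,
`massGapPowerDecayOf_of_polySeparationFloor`).  No mathematics added, no statement changed.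
-/

set_option autoImplicit false

noncomputable section

open MeasureTheory Filter Topology
open Literature.MathematicalPhysics
open Literature.MathematicalPhysics.QuantumFieldTheory
open Literature.MathematicalPhysics.QuantumLattice
open Summit.QuantumFields.YangMills.Theorems

namespace Summit.QuantumFields.YangMills.Theorems.WeakCouplingRates

section Currency

variable {d N : ℕ} {G : Type*} [Group G] [TopologicalSpace G] [IsTopologicalGroup G] [CompactSpace G]
  [MeasurableSpace G] [BorelSpace G]

variable (ρ : G →* Matrix (Fin N) (Fin N) ℂ)

/-! ### §4. PROVED RUNG: translation invariance of torus-limit states and XI-DIV for every compact simple `G` (`d = 4`) -/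

/-- **B-TI.** Torus-limit states are translation invariant on bounded continuous cylinder observables. -/
theorem integral_comp_configShift_of_mem_limitPoints {β : ℝ} {μ : Measure (LGConfig d G)}
    (hμ : μ ∈ infiniteVolumeLimitPoints (d := d) ρ β) (v : Literature.Probability.LatticeModels.Site d)
    {F : LGConfig d G → ℝ} {S : Finset (QuantumLattice.ZdEdge d)} (hFS : IsCylinder F S) (hFc : Continuous F)
    (hFb : ∃ C, ∀ U, |F U| ≤ C) :
    ∫ U, F (configShift v U) ∂μ = ∫ U, F U ∂μ := by
  obtain ⟨L, _hL, _hprob, hconv⟩ := hμ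
  have h1 := hconv (F ∘ configShift v) _ (IsCylinder.comp_configShift hFS v)
    (hFc.comp (continuous_configShift v)) (by obtain ⟨C, hC⟩ := hFb; exact ⟨C, fun U => hC _⟩)
  have h2 := hconv F S hFS hFc hFb
  have hE : (fun k : ℕ => wilsonExpectation (L := L k + 1) ρ β (toTorusObservable (L k + 1) (F ∘ configShift v))) =
      fun k : ℕ => wilsonExpectation (L := L k + 1) ρ β (toTorusObservable (L k + 1) F) := by
    funext k
    rw [toTorusObservable_comp_configShift, wilsonExpectation_comp_torusConfigShift]
  rw [hE] at h1
  exact tendsto_nhds_unique h1 h2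

omit [Group G] [TopologicalSpace G] [IsTopologicalGroup G] [CompactSpace G] [BorelSpace G] in
/-- `α_s ∘ α_k = α_{k+s}`. -/
theorem timeShiftLG_timeShiftLG [NeZero d] (s k : ℕ) (U : LGConfig d G) :
    timeShiftLG (G := G) s (timeShiftLG (G := G) k U) = timeShiftLG (G := G) (k + s) U := by
  ext e
  simp only [timeShiftLG, configShift_apply, sub_sub]
  congr 2
  rw [← neg_add, ← Pi.single_add]
  push_cast
  ring_nf

omit [Group G] [TopologicalSpace G] [IsTopologicalGroup G] [CompactSpace G] [BorelSpace G] in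
/-- `α_{n+s} ∘ (shift by +s e₀) = α_n`. -/
theorem timeShiftLG_add_configShift_single [NeZero d] (n s : ℕ) (U : LGConfig d G) :
    timeShiftLG (G := G) (n + s) (configShift (Pi.single 0 (s : ℤ)) U) = timeShiftLG (G := G) n U := by
  ext e
  simp only [timeShiftLG, configShift_apply, sub_sub]
  congr 2
  rw [Nat.cast_add, Pi.single_add]
  abel

omit [TopologicalSpace G] [IsTopologicalGroup G] [CompactSpace G] [BorelSpace G] in
/-- Time shifts and the site reflection: `α_s ∘ θ = θ ∘ (shift by +s e₀)`. -/
theorem timeShiftLG_timeReflectLG [NeZero d] (s : ℕ) (U : LGConfig d G) :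
    timeShiftLG (G := G) s (timeReflectLG U) = timeReflectLG (configShift (Pi.single 0 (s : ℤ)) U) := by
  have htr : ∀ x : Literature.Probability.LatticeModels.Site d,
      trSite (x + Pi.single 0 (s : ℤ)) = trSite x - Pi.single 0 (s : ℤ) := by
    intro x
    ext k
    by_cases hk : k = 0
    · subst hk
      simp [trSite]
      ring
    · simp [trSite, hk]
  ext e
  obtain ⟨x, i⟩ := e
  by_cases hi : i = 0
  · subst hi
    simp [timeReflectLG, timeShiftLG, configShift_apply, htr]
    rw [sub_right_comm]
  · simp [timeReflectLG, timeShiftLG, configShift_apply, htr, hi]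

set_option maxHeartbeats 800000 in
/-- **XI-DIV for EVERY compact simple `G` (`d = 4`) — PROVED.**  For every `ε > 0` and all large `β`, no infinite-volume torus-limit state of
the Wilson theory with a faithful unitary representation `r` of a compact simple `G` has an RP-spectral mass gap larger than `ε`.  From the
tree's `EquipartitionPinsProbe_proof ∘ freeEnergyLogCoefficient_proof` (route `EquipartitionCriticality`, items 8759/8760: the probe
covariances converge, uniformly over the limit states, to a profile `g` with `g(2s) e^{-ε(2t-2s)} < g(2t)` for some `s < t`), B-TI, and the
two-time form of the spectral bound.  This is the rung BELOW the leaves `XiPowSU2` / `XiPow`.  NOT THE CLAY GAP. -/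
theorem massGapVanishesOf_allSimpleG :
    ∀ (G : Type) [Group G] [TopologicalSpace G] [IsTopologicalGroup G] [CompactSpace G],
      IsCompactSimpleLieGroup G →
      letI : MeasurableSpace G := borel G
      haveI : BorelSpace G := ⟨rfl⟩
      ∀ r : LatticeRep G, MassGapVanishesOf 4 r.ρ := by
  intro G _ _ _ _ hG
  letI : MeasurableSpace G := borel G
  haveI : BorelSpace G := ⟨rfl⟩
  intro r
  obtain ⟨φ, hφc, ⟨Cφ, hCφ⟩, g, hg, hconv⟩ :=
    Summit.QuantumFields.YangMills.Theorems.EquipartitionPinsProbe_proof G hG r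
      (Summit.QuantumFields.YangMills.Theorems.freeEnergyLogCoefficient_proof G hG r)
  intro ε hε
  obtain ⟨s, t, hst, hgs, hgt⟩ := hg ε hε
  set E : ℝ := Real.exp (-(ε * (2 * (t : ℝ) - 2 * (s : ℝ)))) with hEdef
  have hE1 : E ≤ 1 := by
    rw [hEdef]
    refine Real.exp_le_one_iff.2 ?_
    have : (s : ℝ) < t := by exact_mod_cast hst
    nlinarith
  have hgsE : 0 < g (2 * s) * E := mul_pos hgs (Real.exp_pos _)
  have hgt0 : 0 < g (2 * t) := hgsE.trans hgt
  have hδ₀ : 0 < g (2 * t) - g (2 * s) * E := sub_pos.2 hgt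
  set η : ℝ := (g (2 * t) - g (2 * s) * E) / 3 with hηdef
  have hη : 0 < η := by rw [hηdef]; exact div_pos hδ₀ (by norm_num)
  obtain ⟨β₀, hβ₀⟩ := eventually_atTop.1 ((hconv (2 * s) η hη).and (hconv (2 * t) η hη))
  refine ⟨β₀, fun β hβ μ hμ m hm => ?_⟩
  obtain ⟨hs', ht'⟩ := hβ₀ β hβ
  obtain ⟨P, hPdef⟩ : ∃ P : LGConfig 4 G → ℝ, ∀ U, P U = φ (β * ((r.N : ℝ) - plaquetteObs r.ρ 0 1 2 U)) :=
    ⟨_, fun _ => rfl⟩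
  obtain ⟨c, hcdef⟩ : ∃ c : ℕ → ℝ, ∀ n, c n = (∫ U, P U * P (timeShiftLG (G := G) n U) ∂μ) -
      (∫ U, P U ∂μ) * (∫ U, P (timeShiftLG (G := G) n U) ∂μ) := ⟨_, fun _ => rfl⟩
  have hcs : |c (2 * s) - g (2 * s)| < η := by
    have h := hs' μ hμ
    simp only [← hPdef] at h
    rw [hcdef]
    exact h
  have hct : |c (2 * t) - g (2 * t)| < η := by
    have h := ht' μ hμ
    simp only [← hPdef] at h
    rw [hcdef]
    exact h
  have h1 : (1 : Fin 4) ≠ 0 := by decide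
  have h2 : (2 : Fin 4) ≠ 0 := by decide
  obtain ⟨S₀, hcyl, hS⟩ : ∃ S₀ : Finset (QuantumLattice.ZdEdge 4), IsCylinder (plaqCost0 (G := G) r.ρ 1 2) S₀ ∧
      ∀ e ∈ S₀, e.1 0 = 0 ∧ e.2 ≠ 0 := ⟨_, plaqCost0_support (G := G) r.ρ h1 h2⟩
  obtain ⟨hcont0, -⟩ := continuous_bounded_plaqCost0 r.ρ r.continuous (1 : Fin 4) 2
  have hPfun : P = fun U => φ (β * plaqCost0 r.ρ 1 2 U) := funext fun U => by rw [hPdef]; rfl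
  have hPcyl : IsCylinder P S₀ := by
    intro U V h
    rw [hPfun]
    show φ (β * plaqCost0 r.ρ 1 2 U) = φ (β * plaqCost0 r.ρ 1 2 V)
    rw [hcyl h]
  have hPθ : ∀ U, P (timeReflectLG U) = P U := comp_timeReflectLG_eq hPcyl hS
  have hPc : Continuous P := by
    rw [hPfun]
    exact hφc.comp (continuous_const.mul hcont0)
  have hPb : ∀ U, |P U| ≤ Cφ := fun U => by rw [hPdef]; exact hCφ _
  have hCφ0 : 0 ≤ Cφ := (abs_nonneg _).trans (hCφ 0)
  haveI : IsProbabilityMeasure μ := by obtain ⟨_, _, hprob, _⟩ := hμ; exact hprob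
  have hmean : ∀ n : ℕ, ∫ U, P (timeShiftLG (G := G) n U) ∂μ = ∫ U, P U ∂μ := fun n =>
    integral_comp_configShift_of_mem_limitPoints r.ρ hμ _ hPcyl hPc ⟨Cφ, hPb⟩
  have hmeanS : ∫ U, P (configShift (Pi.single 0 (s : ℤ)) U) ∂μ = ∫ U, P U ∂μ :=
    integral_comp_configShift_of_mem_limitPoints r.ρ hμ _ hPcyl hPc ⟨Cφ, hPb⟩
  set F : LGConfig 4 G → ℝ := fun U => P (timeShiftLG (G := G) s U) with hFdef
  have hF : IsPosTimeObs F := by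
    refine ⟨⟨_, isCylinder_timeShift hPcyl s, fun e he => ?_⟩, hPc.comp (continuous_timeShiftLG s), Cφ,
      fun U => hPb _⟩
    obtain ⟨e', he', rfl⟩ := Finset.mem_image.1 he
    have := (hS e' he').1
    simp [this]
  have hcorr : ∀ k : ℕ, rpCorr μ F k = c (k + s + s) := by
    intro k
    have hFθ : ∀ U, F (timeReflectLG U) = P (configShift (Pi.single 0 (s : ℤ)) U) := fun U => by
      simp only [hFdef]
      rw [timeShiftLG_timeReflectLG, hPθ]
    have hFk : ∀ U, F (timeShiftLG (G := G) k U) = P (timeShiftLG (G := G) (k + s) U) := fun U => by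
      simp only [hFdef]
      rw [timeShiftLG_timeShiftLG]
    set J : LGConfig 4 G → ℝ := fun W => P W * P (timeShiftLG (G := G) (k + s + s) W) with hJdef
    have hIJ : ∀ U, P (configShift (Pi.single 0 (s : ℤ)) U) * P (timeShiftLG (G := G) (k + s) U) =
        J (configShift (Pi.single 0 (s : ℤ)) U) := fun U => by
      simp only [hJdef]
      rw [timeShiftLG_add_configShift_single]
    have hJcyl := IsCylinder.mul hPcyl (isCylinder_timeShift hPcyl (k + s + s))
    have hJc : Continuous J := hPc.mul (hPc.comp (continuous_timeShiftLG (k + s + s)))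
    have hJb : ∃ C', ∀ W, |J W| ≤ C' := ⟨Cφ * Cφ, fun W => by
      simp only [hJdef]; rw [abs_mul]
      exact mul_le_mul (hPb _) (hPb _) (abs_nonneg _) hCφ0⟩
    have hJint : ∫ U, J (configShift (Pi.single 0 (s : ℤ)) U) ∂μ = ∫ U, J U ∂μ :=
      integral_comp_configShift_of_mem_limitPoints r.ρ hμ _ hJcyl hJc hJb
    rw [hcdef, hmean]
    simp only [rpCorr, hFθ, hFk, hIJ, hmeanS, hmean]
    rw [hJint]
  have hc0 : rpCorr μ F 0 = c (2 * s) := by rw [hcorr]; congr 1; ring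
  have hck : rpCorr μ F (2 * t - 2 * s) = c (2 * t) := by rw [hcorr]; congr 1; omega
  have hgap := hm.2 F hF (2 * t - 2 * s)
  rw [hck, hc0] at hgap
  have hcast : ((2 * t - 2 * s : ℕ) : ℝ) = 2 * (t : ℝ) - 2 * (s : ℝ) := by
    rw [Nat.cast_sub (by omega)]
    push_cast
    ring
  rw [hcast] at hgap
  refine le_of_not_gt fun hmε => ?_
  have hEm : Real.exp (-(m * (2 * (t : ℝ) - 2 * (s : ℝ)))) ≤ E := by
    rw [hEdef]
    refine Real.exp_le_exp.2 ?_
    have : (s : ℝ) < t := by exact_mod_cast hst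
    nlinarith
  have hcs' := abs_lt.1 hcs
  have hct' := abs_lt.1 hct
  rcases le_or_gt 0 (c (2 * s)) with hpos | hneg
  · have h3 : c (2 * t) ≤ E * c (2 * s) := hgap.trans (mul_le_mul_of_nonneg_right hEm hpos)
    have h4 : E * c (2 * s) ≤ E * (g (2 * s) + η) :=
      mul_le_mul_of_nonneg_left (by linarith [hcs'.2]) (Real.exp_pos _).le
    have h5 : E * η ≤ η := mul_le_of_le_one_left hη.le hE1
    have : g (2 * t) - η < g (2 * s) * E + η := by nlinarith [hct'.1]
    rw [hηdef] at this
    linarith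
  · have h3 : c (2 * t) ≤ 0 :=
      hgap.trans (mul_nonpos_of_nonneg_of_nonpos (Real.exp_pos _).le hneg.le)
    have : g (2 * t) - η < 0 := by linarith [hct'.1]
    rw [hηdef] at this
    nlinarith

end Currency

end Summit.QuantumFields.YangMills.Theorems.WeakCouplingRates

end
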